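import Literature.MathematicalPhysics.QuantumLattice.ApproximatingHamiltonianProofs
import Literature.MathematicalPhysics.QuantumLattice.LiebFluxPhaseProofs
import HarnessLib

/-!
# The approximating Hamiltonian method for an attractive channel at ZERO TEMPERATURE

Sequel of `ApproximatingHamiltonianProofs.lean` (Bogolyubov Jr.'s majorisation method for ONE attractive
separable channel `H_Λ = T − V⁻¹U⋆U`, finite-dimensional boxes). That file proves the finite-volume,
positive-temperature form of Bru–de Siqueira Pedra's Theorem 107: for every inverse temperature `β > 0`
and every `r > 0` there is a source `c ∈ ℂ` with
`p[T − V⁻¹U⋆U] ≤ p[T − (c̄U + cU⋆)] − |c|² + 4rC₁ + Q_β(r)/V`,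
`Q_β(r) = C₂/2 + 2C₁/(βr) + ½(√(C₁κ₁/r) + √(C₁κ₂/r))` (`exists_pressure_model_le`), and the exact
lower bound `p[T − (c̄U + cU⋆)] − |c|² ≤ p[T − V⁻¹U⋆U]` for every `c` (`log_partitionFn_approx_le_model`).

This file sends `β → ∞` in both, using only the elementary sandwich
`e^{−βE₀(H)} ≤ Z_β(H) ≤ dim · e^{−βE₀(H)}` (`exp_neg_mul_groundEnergy_le_partitionFn`,
`partitionFn_le_card_mul_exp`), i.e. `−E₀(H)/V ≤ log Z_β(H)/(βV) ≤ log dim/(βV) − E₀(H)/V`: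

* `groundEnergy_model_div_le_approx_add_sq` — **T = 0 lower bound, exact**: for EVERY `c ∈ ℂ`,
  `E₀(T − V⁻¹U⋆U)/V ≤ E₀(T − (c̄U + cU⋆))/V + |c|²` (the completed square
  `H(c) + |c|²V − H = V⁻¹(U − cV)⋆(U − cV) ≥ 0`, read off at `β → ∞`).
* `exists_groundEnergy_approx_add_sq_le_model` — **T = 0 upper bound** (the `β → ∞` limit of Theorem 107 (ii)):
  under (A2) `‖U‖ ≤ C₁V` and (A3), for every `r > 0` and `ε > 0` there is `c ∈ ℂ` with
  `E₀(T − (c̄U + cU⋆))/V + |c|² ≤ E₀(T − V⁻¹U⋆U)/V + 4rC₁ + Q_∞(r)/V + ε`,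
  `Q_∞(r) = C₂/2 + ½(√(C₁κ₁/r) + √(C₁κ₂/r))` — the `2C₁/(βr)` term of `Q_β` and the `log dim/β` price of
  the sandwich are sent below `ε` by ONE large `β` (no limit of the sources `c_β` is taken).
* `AHM.groundEnergy_model_div_le_approx_add_sq`, `AHM.exists_groundEnergy_approx_add_sq_le_model` — the same two
  statements in the `AHM.model` / `AHM.approx` vocabulary of `ApproximatingHamiltonian.lean` on the boxes
  `Fin (m + 1)`; the second is VERBATIM the `ZeroTemperatureAHMBound` statement typed by the `hubbard-cq`
  transplant lens (TransplantSketch4, F1 at `T = 0`), now a theorem.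

Consequence (not restated): `E₀(T − V⁻¹U⋆U)/V = inf_c [E₀(T − (c̄U + cU⋆))/V + |c|²] + O(r) + O((rV²)^{-1/2}) + O(V⁻¹)`,
the ground-state form of the approximating Hamiltonian method (Bogolubov Jr. 1966, Thm 1, `θ = 0`).
HONEST FRAMING: model-free matrix inequalities; zero compute; no definition, no named fact, no `sorry`.
Cell `hubbard-cq` (dictionary step (α) of the Koma–Tasaki ceiling chain, census (44)), seat `hubbard-cq-p1`.

## References

* J.-B. Bru, W. de Siqueira Pedra, Mem. Amer. Math. Soc. 224 (2013), no. 1052, Appendix "The approximating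
  Hamiltonian method", Theorem 107 (ii) [BruPedra2013].
* N. N. Bogolubov Jr., *On model dynamical systems in statistical mechanics*, Physica 32 (1966) 933–944,
  Theorem 1 (the ground-state / `θ = 0` majorisation) [Bogolubov1966].
* N. N. Bogolyubov Jr., J. G. Brankov, V. A. Zagrebnov, A. M. Kurbatov, N. S. Tonchev, Russ. Math. Surveys
  39:6 (1984) 1–50 [BogolyubovJrEtAl1984] (through [BruPedra2013]).
-/

noncomputable section

open scoped Matrix.Norms.L2Operator ComplexOrder
open Matrix Finset

namespace Literature.MathematicalPhysics.QuantumLattice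

variable {n : Type*} [Fintype n] [DecidableEq n] [Nonempty n]

/-! ### The zero-temperature sandwich in pressure units -/

section Sandwich

variable {H : Matrix n n ℂ}

/-- **`−E₀(H)/V ≤ log Z_β(H)/(βV)`** for Hermitian `H`, `β > 0`, `V > 0` (keep the ground-state term of
`Z_β = Σ e^{−βEᵢ}`: the free energy lies below the ground energy, in pressure units).
[cite: GustafsonSigal2003, §18.3 Theorem 18.10 (proof)] [cite: Lieb1994, Remark (iii)] -/
theorem neg_groundEnergy_div_le_log_partitionFn_div (hH : H.IsHermitian) {β V : ℝ} (hβ : 0 < β)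
    (hV : 0 < V) : -H.groundEnergy / V ≤ Real.log (partitionFn β H).re / (β * V) := by
  have h1 := exp_neg_mul_groundEnergy_le_partitionFn hH β
  have h2 := Real.log_le_log (Real.exp_pos _) h1
  rw [Real.log_exp] at h2
  have e : -H.groundEnergy / V = -(β * H.groundEnergy) / (β * V) := by
    field_simp
  rw [e]
  exact div_le_div_of_nonneg_right h2 (mul_pos hβ hV).le

/-- **`log Z_β(H)/(βV) ≤ log dim/(βV) − E₀(H)/V`** for Hermitian `H`, `β > 0`, `V > 0`
(`Z_β ≤ dim · e^{−βE₀}`: the `β → ∞` step `E₀ = lim −β⁻¹ log Z_β` with the explicit `log dim/β` rate, in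
pressure units). [cite: GustafsonSigal2003, §18.3 (18.12)] [cite: Lieb1994, Remark (iii)] -/
theorem log_partitionFn_div_le_log_card_div_sub (hH : H.IsHermitian) {β V : ℝ} (hβ : 0 < β)
    (hV : 0 < V) : Real.log (partitionFn β H).re / (β * V) ≤
      Real.log (Fintype.card n) / (β * V) - H.groundEnergy / V := by
  have hD : (0 : ℝ) < Fintype.card n := by exact_mod_cast Fintype.card_pos
  have h1 := partitionFn_le_card_mul_exp hH hβ.le
  have hZ := partitionFn_re_pos hH β
  have h2 := Real.log_le_log hZ h1
  rw [Real.log_mul hD.ne' (Real.exp_pos _).ne', Real.log_exp] at h2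
  have e : Real.log (Fintype.card n) / (β * V) - H.groundEnergy / V =
      (Real.log (Fintype.card n) + -(β * H.groundEnergy)) / (β * V) := by
    field_simp
    ring
  rw [e]
  exact div_le_div_of_nonneg_right h2 (mul_pos hβ hV).le

end Sandwich

/-! ### Theorem 107 at zero temperature: one attractive complex channel -/

section ZeroTemperature

variable {T : Matrix n n ℂ}

/-- **T = 0 LOWER BOUND (exact), attractive channel**: for every `c ∈ ℂ`,
`E₀(T − V⁻¹U⋆U)/V ≤ E₀(T − (c̄U + cU⋆))/V + |c|²` — the completed square
`H_Λ(c) + |c|²V − H_Λ = V⁻¹(U − cV)⋆(U − cV) ≥ 0` of Theorem 107, read at `β → ∞`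
(from `log_partitionFn_approx_le_model` and the sandwich: `E₀(H_Λ) − E₀(H_Λ(c)) − V|c|² ≤ log dim/β` for every `β > 0`).
[cite: BruPedra2013, Appendix: The approximating Hamiltonian method, Theorem 107] [cite: Bogolubov1966, Theorem 1] -/
theorem groundEnergy_model_div_le_approx_add_sq (hT : T.IsHermitian) (U : Matrix n n ℂ) {V : ℝ}
    (hV : 0 < V) (c : ℂ) :
    (T - ((V⁻¹ : ℝ) : ℂ) • (Uᴴ * U)).groundEnergy / V ≤
      (T - (starRingEnd ℂ c • U + c • Uᴴ)).groundEnergy / V + ‖c‖ ^ 2 := by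
  have hAp : (T - (starRingEnd ℂ c • U + c • Uᴴ)).IsHermitian :=
    hT.sub (isHermitian_conj_smul_add_smul_conjTranspose U c)
  have hM : (T - ((V⁻¹ : ℝ) : ℂ) • (Uᴴ * U)).IsHermitian :=
    hT.sub (isHermitian_real_smul (posSemidef_conjTranspose_mul_self U).isHermitian V⁻¹)
  have hD : (0 : ℝ) ≤ Real.log (Fintype.card n) :=
    Real.log_nonneg (by exact_mod_cast Nat.one_le_iff_ne_zero.2 Fintype.card_ne_zero)
  -- extensive form: `E₀(H) − E₀(H(c)) − V|c|² ≤ log dim / β` for every `β > 0`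
  have key : ∀ β : ℝ, 0 < β → (T - ((V⁻¹ : ℝ) : ℂ) • (Uᴴ * U)).groundEnergy -
      (T - (starRingEnd ℂ c • U + c • Uᴴ)).groundEnergy - V * ‖c‖ ^ 2 ≤
        Real.log (Fintype.card n) / β := by
    intro β hβ
    have h1 := log_partitionFn_approx_le_model hT U hβ.le hV c
    have hlo := exp_neg_mul_groundEnergy_le_partitionFn hAp β
    have hlo' := Real.log_le_log (Real.exp_pos _) hlo
    rw [Real.log_exp] at hlo'
    have hDpos : (0 : ℝ) < Fintype.card n := by exact_mod_cast Fintype.card_pos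
    have hhi := Real.log_le_log (partitionFn_re_pos hM β) (partitionFn_le_card_mul_exp hM hβ.le)
    rw [Real.log_mul hDpos.ne' (Real.exp_pos _).ne', Real.log_exp] at hhi
    rw [le_div_iff₀ hβ]
    nlinarith
  -- `β → ∞`
  have hle : (T - ((V⁻¹ : ℝ) : ℂ) • (Uᴴ * U)).groundEnergy -
      (T - (starRingEnd ℂ c • U + c • Uᴴ)).groundEnergy - V * ‖c‖ ^ 2 ≤ 0 := by
    refine le_of_forall_pos_le_add fun δ hδ => ?_
    have hβ : 0 < Real.log (Fintype.card n) / δ + 1 := by positivity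
    refine (key _ hβ).trans ?_
    rw [zero_add, div_le_iff₀ hβ]
    have : Real.log (Fintype.card n) = δ * (Real.log (Fintype.card n) / δ) := by
      field_simp
    nlinarith
  rw [div_add' _ _ _ hV.ne', div_le_div_iff_of_pos_right hV]
  nlinarith

/-- **T = 0 UPPER BOUND, attractive channel — the zero-temperature approximating-Hamiltonian bound**
(the `β → ∞` limit of `exists_pressure_model_le`): under (A2) `‖U‖ ≤ C₁V` and (A3)
`‖[U,U⋆]‖ ≤ VC₂`, `‖[U,[U⋆,U]]‖, ‖[U⋆,[U⋆,U]]‖ ≤ VC₃`, `‖[U,[U,T]]‖, ‖[U⋆,[U,T]]‖ ≤ VC₄`, for every `r > 0`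
and every `ε > 0` there is `c ∈ ℂ` with
`E₀(T − (c̄U + cU⋆))/V + |c|² ≤ E₀(T − V⁻¹U⋆U)/V + 4rC₁ + Q_∞(r)/V + ε`,
`Q_∞(r) = C₂/2 + ½(√(C₁κ₁/r) + √(C₁κ₂/r))`, `κ₁ = C₄ + C₁C₃ + C₂²/2`, `κ₂ = C₄ + C₁C₃`
(the thermal error `2C₁/(βr)` and the sandwich price `log dim/β` are `≤ εV` for one large `β`; the source is
the thermal one at that `β`).
[cite: BruPedra2013, Appendix: The approximating Hamiltonian method, Theorem 107 (ii)] [cite: Bogolubov1966, Theorem 1] -/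
theorem exists_groundEnergy_approx_add_sq_le_model (hT : T.IsHermitian) (U : Matrix n n ℂ)
    {V r C₁ C₂ C₃ C₄ : ℝ} (hV : 0 < V) (hr : 0 < r)
    (hU : ‖U‖ ≤ C₁ * V) (h2 : ‖U * Uᴴ - Uᴴ * U‖ ≤ V * C₂)
    (h3a : ‖⁅U, ⁅Uᴴ, U⁆⁆‖ ≤ V * C₃) (h3b : ‖⁅Uᴴ, ⁅Uᴴ, U⁆⁆‖ ≤ V * C₃)
    (h4a : ‖⁅U, ⁅U, T⁆⁆‖ ≤ V * C₄) (h4b : ‖⁅Uᴴ, ⁅U, T⁆⁆‖ ≤ V * C₄) {ε : ℝ} (hε : 0 < ε) :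
    ∃ c : ℂ, (T - (starRingEnd ℂ c • U + c • Uᴴ)).groundEnergy / V + ‖c‖ ^ 2 ≤
      (T - ((V⁻¹ : ℝ) : ℂ) • (Uᴴ * U)).groundEnergy / V +
        (4 * r * C₁ + (C₂ / 2 +
          (Real.sqrt (C₁ * (C₄ + 2 * (C₃ / 2) * C₁ + 2 * (C₂ / 2) ^ 2) / r) +
            Real.sqrt (C₁ * (C₄ + 2 * C₁ * (C₃ / 2)) / r)) / 2) / V) + ε := by
  have hM : (T - ((V⁻¹ : ℝ) : ℂ) • (Uᴴ * U)).IsHermitian :=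
    hT.sub (isHermitian_real_smul (posSemidef_conjTranspose_mul_self U).isHermitian V⁻¹)
  have hC₁ : 0 ≤ C₁ := by
    have h := (norm_nonneg U).trans hU
    exact (mul_nonneg_iff_of_pos_right hV).1 h
  have hD : (0 : ℝ) ≤ Real.log (Fintype.card n) :=
    Real.log_nonneg (by exact_mod_cast Nat.one_le_iff_ne_zero.2 Fintype.card_ne_zero)
  -- the `β`-dependent price `K/β`, `K = 2C₁/(rV) + log dim / V ≥ 0`; choose `β = K/ε + 1`
  set K : ℝ := 2 * C₁ / (r * V) + Real.log (Fintype.card n) / V with hK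
  have hK0 : 0 ≤ K := by positivity
  set β : ℝ := K / ε + 1 with hβdef
  have hβ : 0 < β := by positivity
  have hKβ : K / β ≤ ε := by
    rw [div_le_iff₀ hβ, hβdef]
    have : ε * (K / ε + 1) = K + ε := by field_simp
    rw [this]
    linarith
  obtain ⟨c, hc⟩ := exists_pressure_model_le hT U hβ hV hr hU h2 h3a h3b h4a h4b
  have hAp : (T - (starRingEnd ℂ c • U + c • Uᴴ)).IsHermitian :=
    hT.sub (isHermitian_conj_smul_add_smul_conjTranspose U c)
  have hlo := neg_groundEnergy_div_le_log_partitionFn_div hM hβ hV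
  rw [neg_div] at hlo
  have hhi := log_partitionFn_div_le_log_card_div_sub hAp hβ hV
  refine ⟨c, ?_⟩
  -- split the thermal error into its `β`-independent part and `K/β`
  have hsplit : (4 * r * C₁ + (C₂ / 2 + 2 * C₁ / (β * r) +
      (Real.sqrt (C₁ * (C₄ + 2 * (C₃ / 2) * C₁ + 2 * (C₂ / 2) ^ 2) / r) +
        Real.sqrt (C₁ * (C₄ + 2 * C₁ * (C₃ / 2)) / r)) / 2) / V) +
      Real.log (Fintype.card n) / (β * V) =
      (4 * r * C₁ + (C₂ / 2 +
        (Real.sqrt (C₁ * (C₄ + 2 * (C₃ / 2) * C₁ + 2 * (C₂ / 2) ^ 2) / r) +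
          Real.sqrt (C₁ * (C₄ + 2 * C₁ * (C₃ / 2)) / r)) / 2) / V) + K / β := by
    rw [hK]
    field_simp
    ring
  linarith [hsplit]

/-- **T = 0, two-sided packaging**: under (A2)–(A3), for every `r > 0`, `ε > 0` some source `c` realises the
model's ground-energy density up to the approximating-Hamiltonian error:
`0 ≤ E₀(T − (c̄U + cU⋆))/V + |c|² − E₀(T − V⁻¹U⋆U)/V ≤ 4rC₁ + Q_∞(r)/V + ε`.
[cite: BruPedra2013, Appendix: The approximating Hamiltonian method, Theorem 107 (ii)] [cite: Bogolubov1966, Theorem 1] -/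
theorem exists_groundEnergy_approx_add_sq_sub_model_mem_Icc (hT : T.IsHermitian) (U : Matrix n n ℂ)
    {V r C₁ C₂ C₃ C₄ : ℝ} (hV : 0 < V) (hr : 0 < r)
    (hU : ‖U‖ ≤ C₁ * V) (h2 : ‖U * Uᴴ - Uᴴ * U‖ ≤ V * C₂)
    (h3a : ‖⁅U, ⁅Uᴴ, U⁆⁆‖ ≤ V * C₃) (h3b : ‖⁅Uᴴ, ⁅Uᴴ, U⁆⁆‖ ≤ V * C₃)
    (h4a : ‖⁅U, ⁅U, T⁆⁆‖ ≤ V * C₄) (h4b : ‖⁅Uᴴ, ⁅U, T⁆⁆‖ ≤ V * C₄) {ε : ℝ} (hε : 0 < ε) :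
    ∃ c : ℂ, (T - (starRingEnd ℂ c • U + c • Uᴴ)).groundEnergy / V + ‖c‖ ^ 2 -
        (T - ((V⁻¹ : ℝ) : ℂ) • (Uᴴ * U)).groundEnergy / V ∈
      Set.Icc (0 : ℝ) (4 * r * C₁ + (C₂ / 2 +
          (Real.sqrt (C₁ * (C₄ + 2 * (C₃ / 2) * C₁ + 2 * (C₂ / 2) ^ 2) / r) +
            Real.sqrt (C₁ * (C₄ + 2 * C₁ * (C₃ / 2)) / r)) / 2) / V + ε) := by
  obtain ⟨c, hc⟩ := exists_groundEnergy_approx_add_sq_le_model hT U hV hr hU h2 h3a h3b h4a h4b hε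
  have hlo := groundEnergy_model_div_le_approx_add_sq hT U hV c
  exact ⟨c, ⟨by linarith, by linarith⟩⟩

end ZeroTemperature

end Literature.MathematicalPhysics.QuantumLattice

/-! ### The same in the `AHM.model` / `AHM.approx` vocabulary (boxes `Fin (m + 1)`) -/

namespace Literature.MathematicalPhysics.QuantumLattice.AHM

open Literature.MathematicalPhysics.QuantumLattice

/-- **T = 0 lower bound in `AHM` vocabulary**: `E₀(AHM.model T U V)/V ≤ E₀(AHM.approx T U c)/V + |c|²` for every
`c`. [cite: BruPedra2013, Appendix: The approximating Hamiltonian method, Theorem 107] -/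
theorem groundEnergy_model_div_le_approx_add_sq (m : ℕ) {T : Matrix (Fin (m + 1)) (Fin (m + 1)) ℂ}
    (hT : T.IsHermitian) (U : Matrix (Fin (m + 1)) (Fin (m + 1)) ℂ) {V : ℝ} (hV : 0 < V) (c : ℂ) :
    (AHM.model T U V).groundEnergy / V ≤ (AHM.approx T U c).groundEnergy / V + ‖c‖ ^ 2 :=
  Literature.MathematicalPhysics.QuantumLattice.groundEnergy_model_div_le_approx_add_sq hT U hV c

/-- **T = 0 upper bound in `AHM` vocabulary** — verbatim the `ZeroTemperatureAHMBound` statement of the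
`hubbard-cq` transplant lens (F1 at `T = 0`): under (A2)–(A3), for every `r > 0`, `ε > 0` there is `c ∈ ℂ` with
`E₀(AHM.approx T U c)/V + |c|² ≤ E₀(AHM.model T U V)/V + 4rC₁ + Q_∞(r)/V + ε`.
[cite: BruPedra2013, Appendix: The approximating Hamiltonian method, Theorem 107 (ii)] [cite: Bogolubov1966, Theorem 1] -/
theorem exists_groundEnergy_approx_add_sq_le_model (m : ℕ) (T U : Matrix (Fin (m + 1)) (Fin (m + 1)) ℂ)
    (V r C₁ C₂ C₃ C₄ : ℝ) (hT : T.IsHermitian) (hV : 0 < V) (hr : 0 < r)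
    (hU : ‖U‖ ≤ C₁ * V) (h2 : ‖U * Uᴴ - Uᴴ * U‖ ≤ V * C₂)
    (h3a : ‖⁅U, ⁅Uᴴ, U⁆⁆‖ ≤ V * C₃) (h3b : ‖⁅Uᴴ, ⁅Uᴴ, U⁆⁆‖ ≤ V * C₃)
    (h4a : ‖⁅U, ⁅U, T⁆⁆‖ ≤ V * C₄) (h4b : ‖⁅Uᴴ, ⁅U, T⁆⁆‖ ≤ V * C₄) (ε : ℝ) (hε : 0 < ε) :
    ∃ c : ℂ, (AHM.approx T U c).groundEnergy / V + ‖c‖ ^ 2 ≤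
      (AHM.model T U V).groundEnergy / V +
        (4 * r * C₁ + (C₂ / 2 +
          (Real.sqrt (C₁ * (C₄ + 2 * (C₃ / 2) * C₁ + 2 * (C₂ / 2) ^ 2) / r) +
            Real.sqrt (C₁ * (C₄ + 2 * C₁ * (C₃ / 2)) / r)) / 2) / V) + ε :=
  Literature.MathematicalPhysics.QuantumLattice.exists_groundEnergy_approx_add_sq_le_model hT U hV hr hU h2
    h3a h3b h4a h4b hε

end Literature.MathematicalPhysics.QuantumLattice.AHM

end
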